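import Literature.MathematicalPhysics.QuantumFieldTheory.Balaban1983to89.B12B0Restriction267
import Literature.MathematicalPhysics.QuantumFieldTheory.Balaban1983to89.B12HOperator267

/-!
# `Balaban1983to89.B12B0RestrictionMainTerm` — the p. 266–267 rider «restrictions on B′(b₀(c)) with ε₁ replaced by
O(ε₁)» for the TYPED MAIN TERM `Q₀` of `LQ̃`: the hypotheses (L) and (H) of `B12B0Restriction267.norm_apply_b0_le`
DISCHARGED on `ℤᵈ`, with `O(1) = Lᵈ`

HONEST FRAMING (cell `lit-balaban`, verbatim): statement-level skeleton of published theorems with citation tags;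
proofs where landed; nothing here is a claim about the Yang–Mills mass gap.

CITATION HEADER.  T. Bałaban, *Renormalization group approach to lattice gauge field theories. I*, Commun. Math.
Phys. **109** (1987) 249–301 [Balaban1987RG1] (cell paper B12), pp. 266–268 [PDF 18–20]; the main term `Q₀` of the
linearized averaging is [Balaban1985Averaging] ([B7]) p. 28, typed `B7Eq61Linearization.Q0` and studied in
`B12HOperator267` (the operator `h` of p. 267).  Unit `lit-balaban-r09` gen 10, SKELETON rows `B12.Eq2.9` (rider),
`B12.Def@267`, `B12.Eq2.11`.

WHAT IS PRINTED (p. 266–267, verbatim): *«The above restrictions imply also restrictions on B′(b₀(c)), with the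
constant ε₁ replaced by O(ε₁), because these variables can be expressed in terms of the remaining ones as in the first
step.»*; p. 267: *«h(c) is a linear operator on the Lie algebra 𝐠, equal to an inverse of a coefficient at the variable
B′(b₀(c)) in (Q̃B′)(c), multiplied by L⁻¹.»*

THE TYPING.  `B12B0Restriction267.norm_apply_b0_le` proves the rider at the linear level from three structural
hypotheses on the linear constraint map: (L) a locality BOUND `‖(ΛB)(c)‖ ≤ K·sup_{N(c)}‖B‖`, (H) the corridor
coefficient bounded below `‖X‖ ≤ H‖coeff_c X‖`, (S) separation.  This module DISCHARGES all three for the typed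
main term `Λ = Q₀` (`B12HOperator267.Q0ₗ L T R`, `(Q₀A)(c) = Σ_{x∈B(c₋)} L⁻ᵈ Σ_{l<L} R(V₀(Γ_{c₋,x} ∪ [x, x+le_μ]))
A(x + le_μ, μ)`) in the operator-norm model `G = ConjAct Aˣ` acting on a normed algebra `A` by conjugation, for
BONDWISE UNITARY data (`‖U(b)‖ ≤ 1`, `‖U(b)⁻¹‖ ≤ 1`, the regime of [B12]: `G`-valued bond variables): (L) with
`K = L` and `N(c)` = the bonds of `B(c₋) ∪ B(c₊)` (`B7BlockGeometry.qppBonds`), (H) with `H = Lᵈ/L = L^{d−1}` under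
`B12HOperator267.AxisStraight` (the corridor coefficient is `L^{1−d}·Ad_{g(c)}`, `coef_eq_of_axisStraight`; axis-
straightness holds for the printed contours, `axisStraight_gammaT`), (S) = `B13CorridorSeparation.eq_of_b0Z_mem_qppBonds`.
Hence **on `{Q₀A = 0}`: `‖A(b₀(c))‖ ≤ Lᵈ · sup_{b ∉ b₀(T⁽ᵏ⁺¹⁾)} ‖A(b)‖`** — print's `O(1)` is `Lᵈ` for the main
term (no smallness, every background).  NOT CLAIMED: the same for [I]'s full `LQ̃` (its coefficient differs from the
main term's by `O(ε)`, `B12AverageCorridor267`; the operator bound (L) for it is not in the tree).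

WHAT IS PROVED (kernel-checked; no `sorry`, standard axioms; no `Prop`-valued named fact — `BondUnitary` is a
predicate with a body, discharged for flat data in `bondUnitary_one`).
* §1 `norm_ofConjAct_list_prod_le_one` / `…_inv_le_one` (products of unitaries), `BondUnitary`, `bondUnitary_one`,
  `norm_gammaT_le_one` / `norm_gammaT_inv_le_one` (the printed block transporters `R(V₀(Γ_{y,x}))` are unitary).
* §2 (L): `norm_transport_smul_le`, **`norm_lineRA_le`** (`≤ L·M`), **`norm_Q0_le`** (`‖(Q₀A)(c)‖ ≤ L·M` whenever
  `‖A(b)‖ ≤ M` on the bonds of `B(c₋) ∪ B(c₊)`).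
* §3 (H): **`norm_le_of_coef`** (`‖X‖ ≤ (Lᵈ/L)·‖K(c)X‖` under `AxisStraight`), `coeff_Q0ₗ_eq_coef` (the abstract
  `coeff` of `B12B0Restriction267` at `Q₀` IS `B12HOperator267.coef`).
* §4 **`norm_b0Z_le_of_Q0_eq_zero`** (the rider for the main term: `O(1) = Lᵈ`), **`norm_b0Z_le_gammaT`** (the same
  with the printed contours `T = gammaT L R`, hypothesis-free but for bondwise unitarity of `R`), and the sup form
  `norm_b0Z_lt_of_Q0_eq_zero` («with the constant ε₁ replaced by O(ε₁)»: `< ε₁` off `b₀` ⇒ `≤ Lᵈε₁` on `b₀`).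

DOCFIX (unit `lit-balaban-r09` gen 13): the four «(0.8) p.252» locators of § 1 → «(0.8) p.253» ([I] p. 253 carries (0.4)–(0.11); CITELOC row P31-193 of `pub-balaban` summit-lit1, confirmed on the page image `…/1987-cmp109-rg-I-small-field-p005-x2.png` by this seat); no declaration, statement or proof changed.
-/

noncomputable section

namespace Literature.MathematicalPhysics.QuantumFieldTheory.Balaban1983to89.B12B0RestrictionMainTerm

open Finset
open Literature.MathematicalPhysics.QuantumLattice (ZdEdge blockSites card_blockSites)
open B7BlockGeometry (qppBonds)
open B7Eq61Linearization (pathProd pathProd_zero pathProd_succ lineR lineRA Q0 Q0_apply conjAct_smul_eq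
  norm_conjAct_smul_le)
open B12HOperator267 (Q0ₗ Q0ₗ_apply coef bcoef AxisStraight gcorner coef_eq_of_axisStraight line_bond_mem_qppBonds
  norm_ofConjAct_pathProd_le_one norm_ofConjAct_pathProd_inv_le_one gammaT axisStraight_gammaT)
open B13CorridorSeparation (b0Z eq_of_b0Z_mem_qppBonds)
open B12B0Restriction267 (coeff coeff_apply norm_apply_b0_le)

variable {d : ℕ} {A : Type*} [NormedRing A] [NormOneClass A]

/-! ## 1. Unitary data in the operator norm -/

/-- A product of group elements whose underlying units have norm `≤ 1` has norm `≤ 1` (products of `G`-valued bond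
variables stay in the unit ball of the operator norm). [cite: Balaban1987RG1, (0.8) p.253] -/
theorem norm_ofConjAct_list_prod_le_one :
    ∀ (l : List (ConjAct Aˣ)), (∀ g ∈ l, ‖((ConjAct.ofConjAct g : Aˣ) : A)‖ ≤ 1) →
      ‖((ConjAct.ofConjAct l.prod : Aˣ) : A)‖ ≤ 1
  | [], _ => by rw [List.prod_nil, map_one, Units.val_one, norm_one]
  | g :: l, h => by
    rw [List.prod_cons, map_mul, Units.val_mul]
    exact (norm_mul_le _ _).trans (mul_le_one₀ (h g (by simp)) (norm_nonneg _)
      (norm_ofConjAct_list_prod_le_one l fun g' hg' => h g' (by simp [hg'])))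

/-- … and so has its inverse when the inverses of the factors have norm `≤ 1`. [cite: Balaban1987RG1, (0.8) p.253] -/
theorem norm_ofConjAct_list_prod_inv_le_one :
    ∀ (l : List (ConjAct Aˣ)), (∀ g ∈ l, ‖(((ConjAct.ofConjAct g)⁻¹ : Aˣ) : A)‖ ≤ 1) →
      ‖(((ConjAct.ofConjAct l.prod)⁻¹ : Aˣ) : A)‖ ≤ 1
  | [], _ => by rw [List.prod_nil, map_one, inv_one, Units.val_one, norm_one]
  | g :: l, h => by
    rw [List.prod_cons, map_mul, mul_inv_rev, Units.val_mul]
    exact (norm_mul_le _ _).trans (mul_le_one₀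
      (norm_ofConjAct_list_prod_inv_le_one l fun g' hg' => h g' (by simp [hg'])) (norm_nonneg _) (h g (by simp)))

/-- BONDWISE UNITARITY in the operator norm: `‖U(b)‖ ≤ 1` and `‖U(b)⁻¹‖ ≤ 1` for every bond (the regime of [B12],
`G`-valued bond variables; for unitary matrices both hold with equality). [cite: Balaban1987RG1, (0.8) p.253] -/
def BondUnitary (R : ZdEdge d → ConjAct Aˣ) : Prop :=
  ∀ b, ‖((ConjAct.ofConjAct (R b) : Aˣ) : A)‖ ≤ 1 ∧ ‖(((ConjAct.ofConjAct (R b))⁻¹ : Aˣ) : A)‖ ≤ 1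

/-- The flat configuration `U = 1` is bondwise unitary (non-vacuity of `BondUnitary`). [cite: Balaban1987RG1, (0.8) p.253] -/
theorem bondUnitary_one : BondUnitary (fun _ : ZdEdge d => (1 : ConjAct Aˣ)) :=
  fun _ => by simp

/-- Straight transporters `R(V₀([x, x + le_μ]))` of bondwise-unitary data are unitary.
[cite: Balaban1987RG1, (0.11) p.253] -/
theorem norm_lineR_le_one {R : ZdEdge d → ConjAct Aˣ} (hR : BondUnitary R) (x : Fin d → ℤ) (μ : Fin d) (l : ℕ) :
    ‖((ConjAct.ofConjAct (lineR R x μ l) : Aˣ) : A)‖ ≤ 1 ∧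
      ‖(((ConjAct.ofConjAct (lineR R x μ l))⁻¹ : Aˣ) : A)‖ ≤ 1 :=
  ⟨norm_ofConjAct_pathProd_le_one _ (fun _ => (hR _).1) l, norm_ofConjAct_pathProd_inv_le_one _ (fun _ => (hR _).2) l⟩

/-- The printed block transporters `R(V₀(Γ_{y,x}))` ([2] (1.7), `B12HOperator267.gammaT`) of bondwise-unitary data are
unitary. [cite: Balaban1987RG1, (0.11) p.253] -/
theorem norm_gammaT_le_one {R : ZdEdge d → ConjAct Aˣ} (hR : BondUnitary R) (L : ℕ) (x : Fin d → ℤ) :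
    ‖((ConjAct.ofConjAct (gammaT L R x) : Aˣ) : A)‖ ≤ 1 ∧
      ‖(((ConjAct.ofConjAct (gammaT L R x))⁻¹ : Aˣ) : A)‖ ≤ 1 := by
  unfold gammaT
  refine ⟨norm_ofConjAct_list_prod_le_one _ fun g hg => ?_, norm_ofConjAct_list_prod_inv_le_one _ fun g hg => ?_⟩
  · obtain ⟨i, -, rfl⟩ := List.mem_map.1 hg
    exact (norm_lineR_le_one hR _ _ _).1
  · obtain ⟨i, -, rfl⟩ := List.mem_map.1 hg
    exact (norm_lineR_le_one hR _ _ _).2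

variable [NormedAlgebra ℝ A]

/-! ## 2. (L) The locality bound for the main term: `‖(Q₀A)(c)‖ ≤ L · sup_{B(c₋)∪B(c₊)} ‖A‖` -/

section Locality

variable {L : ℕ} {T : (Fin d → ℤ) → ConjAct Aˣ} {R : ZdEdge d → ConjAct Aˣ}

omit [NormedAlgebra ℝ A] in
/-- One transported term: `‖(T(x)·R(V₀([x, x+le_μ])))·v‖ ≤ ‖v‖` for unitary data (the rotations `R(·)` of p. 267's
linearization are isometries). [cite: Balaban1987RG1, p.267] -/
theorem norm_transport_smul_le
    (hT : ∀ x, ‖((ConjAct.ofConjAct (T x) : Aˣ) : A)‖ ≤ 1 ∧ ‖(((ConjAct.ofConjAct (T x))⁻¹ : Aˣ) : A)‖ ≤ 1)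
    (hR : BondUnitary R) (x : Fin d → ℤ) (μ : Fin d) (l : ℕ) (v : A) :
    ‖(T x * lineR R x μ l) • v‖ ≤ ‖v‖ := by
  refine norm_conjAct_smul_le _ v ?_ ?_
  · rw [map_mul, Units.val_mul]
    exact (norm_mul_le _ _).trans (mul_le_one₀ (hT x).1 (norm_nonneg _) (norm_lineR_le_one hR x μ l).1)
  · rw [map_mul, mul_inv_rev, Units.val_mul]
    exact (norm_mul_le _ _).trans (mul_le_one₀ (norm_lineR_le_one hR x μ l).2 (norm_nonneg _) (hT x).2)

omit [NormedAlgebra ℝ A] in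
/-- `‖(R_{0,c₋}A)([x, x(c)])‖ ≤ L·M` when `‖A(b)‖ ≤ M` on the bonds of `B(c₋) ∪ B(c₊)` and `x ∈ B(c₋)` (the `L` bonds
of `[x, x(c)]` lie there, `B12HOperator267.line_bond_mem_qppBonds`). [cite: Balaban1987RG1, p.267] -/
theorem norm_lineRA_le (hL : 0 < L)
    (hT : ∀ x, ‖((ConjAct.ofConjAct (T x) : Aˣ) : A)‖ ≤ 1 ∧ ‖(((ConjAct.ofConjAct (T x))⁻¹ : Aˣ) : A)‖ ≤ 1)
    (hR : BondUnitary R) (X : ZdEdge d → A) (c : ZdEdge d) {x : Fin d → ℤ} (hx : x ∈ blockSites L c.1) {M : ℝ}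
    (hM : ∀ b ∈ (qppBonds L c : Set (ZdEdge d)), ‖X b‖ ≤ M) :
    ‖lineRA L T R X x c.2‖ ≤ L * M := by
  have hterm : ∀ l ∈ range L, ‖(T x * lineR R x c.2 l) • X (x + Pi.single c.2 (l : ℤ), c.2)‖ ≤ M := by
    intro l hl
    refine (norm_transport_smul_le hT hR x c.2 l _).trans (hM _ ?_)
    rw [Finset.mem_coe]
    exact line_bond_mem_qppBonds hL c hx (mem_range.1 hl)
  have hsum := Finset.sum_le_sum hterm
  rw [sum_const, card_range, nsmul_eq_mul] at hsum
  exact (norm_sum_le _ _).trans hsum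

/-- **(L) FOR THE MAIN TERM**: `‖(Q₀A)(c)‖ ≤ L·M` whenever `‖A(b)‖ ≤ M` on the bonds of `B(c₋) ∪ B(c₊)` (`Lᵈ` sites,
weight `L⁻ᵈ`, `L` unitarily transported bond variables each). [cite: Balaban1987RG1, p.267] -/
theorem norm_Q0_le (hL : 0 < L)
    (hT : ∀ x, ‖((ConjAct.ofConjAct (T x) : Aˣ) : A)‖ ≤ 1 ∧ ‖(((ConjAct.ofConjAct (T x))⁻¹ : Aˣ) : A)‖ ≤ 1)
    (hR : BondUnitary R) (X : ZdEdge d → A) (c : ZdEdge d) (M : ℝ)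
    (hM : ∀ b ∈ (qppBonds L c : Set (ZdEdge d)), ‖X b‖ ≤ M) :
    ‖Q0 L T R X c‖ ≤ L * M := by
  have hLd : (0 : ℝ) < (L : ℝ) ^ d := by positivity
  rw [Q0_apply]
  calc ‖∑ x ∈ blockSites L c.1, ((L : ℝ) ^ d)⁻¹ • lineRA L T R X x c.2‖
      ≤ ∑ x ∈ blockSites L c.1, ‖((L : ℝ) ^ d)⁻¹ • lineRA L T R X x c.2‖ := norm_sum_le _ _
    _ ≤ ∑ _x ∈ blockSites L c.1, ((L : ℝ) ^ d)⁻¹ * (L * M) := sum_le_sum fun x hx => by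
        rw [norm_smul, norm_inv, Real.norm_of_nonneg hLd.le]
        exact mul_le_mul_of_nonneg_left (norm_lineRA_le hL hT hR X c hx hM) (inv_nonneg.2 hLd.le)
    _ = L * M := by
        rw [sum_const, card_blockSites, nsmul_eq_mul, Nat.cast_pow]
        field_simp

end Locality

/-! ## 3. (H) The corridor coefficient of the main term is bounded below: `‖X‖ ≤ (Lᵈ/L)‖K(c)X‖` -/

section Coefficient

variable {L : ℕ} {T : (Fin d → ℤ) → ConjAct Aˣ} {R : ZdEdge d → ConjAct Aˣ}

/-- **(H) FOR THE MAIN TERM**: under straight axis contours the corridor coefficient is `K(c) = L^{1−d}·Ad_{g(c)}`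
(`B12HOperator267.coef_eq_of_axisStraight`), so for unitary `g(c)` (conjugation by `g(c)⁻¹` non-expansive)
`‖X‖ = ‖g(c)⁻¹·(g(c)·X)‖ ≤ ‖g(c)·X‖ = (Lᵈ/L)·‖K(c)X‖` — the invertibility «h(c) … an inverse of a coefficient at the
variable B′(b₀(c))» with the norm `H = L^{d−1}`. [cite: Balaban1987RG1, p.267] -/
theorem norm_le_of_coef (hTs : AxisStraight L T R) (hL : 0 < L) (hR : BondUnitary R) (c : ZdEdge d) (X : A) :
    ‖X‖ ≤ ((L : ℝ) ^ d / L) * ‖coef L T R c X‖ := by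
  have hLr : (0 : ℝ) < L := by exact_mod_cast hL
  have hLd : (0 : ℝ) < (L : ℝ) ^ d := by positivity
  have hg := norm_lineR_le_one hR (Literature.MathematicalPhysics.QuantumLattice.blockBase L c.1) c.2 (L - 1)
  -- `‖X‖ ≤ ‖g(c) • X‖` by non-expansiveness of `g(c)⁻¹`
  have h1 : ‖X‖ ≤ ‖gcorner L R c • X‖ := by
    have := norm_conjAct_smul_le (gcorner L R c)⁻¹ (gcorner L R c • X) (by rw [map_inv]; exact hg.2)
      (by rw [map_inv, inv_inv]; exact hg.1)
    rwa [smul_smul, inv_mul_cancel, one_smul] at this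
  rw [coef_eq_of_axisStraight hTs c X, norm_smul, Real.norm_of_nonneg (by positivity)]
  calc ‖X‖ ≤ ‖gcorner L R c • X‖ := h1
    _ = ((L : ℝ) ^ d / L) * ((((L : ℝ) ^ d)⁻¹ * L) * ‖gcorner L R c • X‖) := by
        field_simp
    _ = _ := by ring

omit [NormOneClass A] in
/-- The abstract corridor coefficient of `B12B0Restriction267` at `Λ = Q₀` is `B12HOperator267.bcoef …` =
`B12HOperator267.coef …` (`bcoef_Q0`). [cite: Balaban1987RG1, p.267] -/
theorem coeff_Q0ₗ_eq_coef (hL : 0 < L) (T : (Fin d → ℤ) → ConjAct Aˣ) (R : ZdEdge d → ConjAct Aˣ) (c : ZdEdge d)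
    (X : A) : coeff (b0Z L) (Q0ₗ L T R) c X = coef L T R c X := by
  rw [coeff_apply, Q0ₗ_apply]
  exact B12HOperator267.bcoef_Q0 hL T R c X

end Coefficient

/-! ## 4. The rider for the main term: `‖A(b₀(c))‖ ≤ Lᵈ · sup_{b ∉ b₀} ‖A(b)‖` on `{Q₀A = 0}` -/

section Rider

variable {L : ℕ} {T : (Fin d → ℤ) → ConjAct Aˣ} {R : ZdEdge d → ConjAct Aˣ}

/-- **THE p. 266–267 RIDER FOR THE TYPED MAIN TERM, `O(1) = Lᵈ`**: for bondwise-unitary data with straight axis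
contours, every `A` with `Q₀A = 0` and `‖A(b)‖ ≤ M` at the non-distinguished bonds satisfies `‖A(b₀(c))‖ ≤ Lᵈ·M` at
every distinguished bond — `B12B0Restriction267.norm_apply_b0_le` with (L) `K = L` (`norm_Q0_le`), (H) `H = Lᵈ/L`
(`norm_le_of_coef`), (S) `B13CorridorSeparation.eq_of_b0Z_mem_qppBonds`. [cite: Balaban1987RG1, p.266] -/
theorem norm_b0Z_le_of_Q0_eq_zero (hL : 0 < L) (hTs : AxisStraight L T R)
    (hT : ∀ x, ‖((ConjAct.ofConjAct (T x) : Aˣ) : A)‖ ≤ 1 ∧ ‖(((ConjAct.ofConjAct (T x))⁻¹ : Aˣ) : A)‖ ≤ 1)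
    (hR : BondUnitary R) {X : ZdEdge d → A} (hX : Q0 L T R X = 0) {M : ℝ} (hM0 : 0 ≤ M)
    (hM : ∀ b : ZdEdge d, (¬ ∃ c, b0Z L c = b) → ‖X b‖ ≤ M) (c : ZdEdge d) :
    ‖X (b0Z L c)‖ ≤ (L : ℝ) ^ d * M := by
  have hLr : (0 : ℝ) < L := by exact_mod_cast hL
  have hX' : Q0ₗ L T R X = 0 := by rw [Q0ₗ_apply]; exact hX
  have key := norm_apply_b0_le (b₀ := b0Z L) (N := fun c => (qppBonds L c : Set (ZdEdge d)))
    (Λ := Q0ₗ L T R) (K := (L : ℝ)) (H := (L : ℝ) ^ d / L) (M := M)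
    (fun B c M hB => by rw [Q0ₗ_apply]; exact norm_Q0_le hL hT hR B c M hB)
    (fun c X => by rw [coeff_Q0ₗ_eq_coef hL]; exact norm_le_of_coef hTs hL hR c X) (by positivity)
    (fun c c' h => eq_of_b0Z_mem_qppBonds hL (Finset.mem_coe.1 h)) hX' hM0 hM c
  calc ‖X (b0Z L c)‖ ≤ (L : ℝ) ^ d / L * L * M := key
    _ = (L : ℝ) ^ d * M := by field_simp

/-- **The same with the PRINTED contours** `T = R(V₀(Γ_{y,x}))` (`B12HOperator267.gammaT`, axis-straight by
`axisStraight_gammaT`, unitary by `norm_gammaT_le_one`): only bondwise unitarity of the background is assumed.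
[cite: Balaban1987RG1, p.266] -/
theorem norm_b0Z_le_gammaT (hL : 0 < L) (hR : BondUnitary R) {X : ZdEdge d → A}
    (hX : Q0 L (gammaT L R) R X = 0) {M : ℝ} (hM0 : 0 ≤ M)
    (hM : ∀ b : ZdEdge d, (¬ ∃ c, b0Z L c = b) → ‖X b‖ ≤ M) (c : ZdEdge d) :
    ‖X (b0Z L c)‖ ≤ (L : ℝ) ^ d * M :=
  norm_b0Z_le_of_Q0_eq_zero hL (axisStraight_gammaT hL R) (fun x => norm_gammaT_le_one hR L x) hR hX hM0 hM c

/-- «with the constant ε₁ replaced by O(ε₁)»: if the remaining variables are `< ε₁` then the eliminated ones are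
`≤ Lᵈ·ε₁` (main term, printed contours). [cite: Balaban1987RG1, p.266] -/
theorem norm_b0Z_lt_of_Q0_eq_zero (hL : 0 < L) (hR : BondUnitary R) {X : ZdEdge d → A}
    (hX : Q0 L (gammaT L R) R X = 0) {ε₁ : ℝ} (hε : 0 < ε₁)
    (hM : ∀ b : ZdEdge d, (¬ ∃ c, b0Z L c = b) → ‖X b‖ < ε₁) (c : ZdEdge d) :
    ‖X (b0Z L c)‖ ≤ (L : ℝ) ^ d * ε₁ :=
  norm_b0Z_le_gammaT hL hR hX hε.le (fun b hb => (hM b hb).le) c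

end Rider

end Literature.MathematicalPhysics.QuantumFieldTheory.Balaban1983to89.B12B0RestrictionMainTerm

end
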